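import Summits.Parity.GeneralizedHardyLittlewood.Theorems.PrimeLevelFamEdgeMomentsBeyondDiagonalDiagRemHyperbolaProduct
import Summits.Parity.GeneralizedHardyLittlewood.Theorems.BeyondDiagonalBeatsQuarter.KernelFormXSqLocal
import Literature.NumberTheory.LFunctions.SiegelWalfiszLiouville
import HarnessLib

/-!
# Route `PrimeLevelFamEdge`, crux K_A `MomentsBeyondDiagonal` (stmt-Parity-20007), line «petersson_layers» v4, stub `stub_diag`:
# **the good kernels `β_i(j) = Σ_{de=j} μ(d)μ(e)(log d − log e)ⁱ/(de)` have convergent partial sums with a power-of-log rate**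
# (brick D2b of «D4TAIL»)

The kernels produced by the `t`-deformed rearrangement `…DiagRemDeformedIdentity.sum_copTauW_decorFour_eq_deformed` are
`β_i(j) = Σ_{de=j} G(d)G(e)(log d − log e)ⁱ` (`G = μ/id`). Expanding the binomial, `Σ_{j ≤ z} β_i(j) = Σ_a C(i,a)(−1)^{i−a}U_{a,i−a}(z)`
with the hyperbola sums `U_{ab}` of `…DiagRemHyperbolaProduct`, each of which converges with a power-of-log rate. Hence:

* `sum_sum_divisorsAntidiagonal_G_logDiff_pow_eq` — the binomial/hyperbola rearrangement (exact);
* `exists_abs_sum_G_logDiff_kernel_sub_le_pow` — **`∀ i, ∃ κ_i, ∀ N, ∃ K ≥ 0, ∀ z ≥ 1: |Σ_{j ≤ z} β_i(j) − κ_i| ≤ K/(1+log z)ᴺ`**.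

Def-free; theorems only. Helper `--supports stmt-Parity-20007`; closes nothing; K_A, K_B and the Parity summit are NOT proved;
nothing about Landau–Siegel zeros.

## References
* H. L. Montgomery, R. C. Vaughan, *Multiplicative Number Theory I*, CUP 2007, §2.1 and §8.1.
  [cite: MontgomeryVaughan2007, §2.1 — derivation (product of two convergent sums)]
-/

noncomputable section

open Finset Real ArithmeticFunction

namespace Summit.Parity.GeneralizedHardyLittlewood.Theorems.MomentsBeyondDiagonal.DiagCorner

open Literature.NumberTheory.LFunctions.KMV2000.MollifierMainTerm (G)
open Summit.Parity.GeneralizedHardyLittlewood.Theorems.BeyondDiagonalBeatsQuarter.KernelFormXSq (G_apply')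
open Literature.NumberTheory.LFunctions.SiegelWalfiszLiouville (sum_Ioc_sum_divisorsAntidiagonal_eq)
open Literature.Barriers.Parity (Icc_one_eq_Ioc_zero)

/-- **Binomial/hyperbola rearrangement of the good kernels**:
`Σ_{j ≤ Z}Σ_{de=j} G(d)G(e)(log d − log e)ⁱ = Σ_{a ≤ i} C(i,a)(−1)^{i−a}·Σ_{d ≤ Z}Σ_{e ≤ Z/d} (μ(d)logᵃd/d)(μ(e)log^{i−a}e/e)`.
[cite: MontgomeryVaughan2007, §2.1 — derivation] -/
theorem sum_sum_divisorsAntidiagonal_G_logDiff_pow_eq (i Z : ℕ) :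
    ∑ j ∈ Icc 1 Z, ∑ x ∈ j.divisorsAntidiagonal, G x.1 * G x.2 * (Real.log x.1 - Real.log x.2) ^ i =
      ∑ a ∈ Finset.range (i + 1), (Nat.choose i a : ℝ) * (-1) ^ (i - a) *
        ∑ d ∈ Icc 1 Z, ∑ e ∈ Icc 1 (Z / d),
          (ArithmeticFunction.moebius d : ℝ) / d * Real.log d ^ a *
            ((ArithmeticFunction.moebius e : ℝ) / e * Real.log e ^ (i - a)) := by
  rw [Icc_one_eq_Ioc_zero, sum_Ioc_sum_divisorsAntidiagonal_eq
    (fun d e ↦ G d * G e * (Real.log d - Real.log e) ^ i) Z, ← Icc_one_eq_Ioc_zero]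
  -- expand the binomial termwise and swap the finite sums
  have hpt : ∀ d e : ℕ, G d * G e * (Real.log d - Real.log e) ^ i =
      ∑ a ∈ Finset.range (i + 1), (Nat.choose i a : ℝ) * (-1) ^ (i - a) *
        ((ArithmeticFunction.moebius d : ℝ) / d * Real.log d ^ a *
          ((ArithmeticFunction.moebius e : ℝ) / e * Real.log e ^ (i - a))) := by
    intro d e
    rw [sub_eq_add_neg, add_pow, Finset.mul_sum]
    refine Finset.sum_congr rfl fun a _ ↦ ?_
    rw [G_apply', G_apply', neg_pow]
    ring
  simp_rw [hpt, Finset.mul_sum]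
  rw [Finset.sum_comm]
  refine Finset.sum_congr rfl fun d _ ↦ ?_
  rw [← Icc_one_eq_Ioc_zero, Finset.sum_comm]

/-- **The good kernels have convergent partial sums with a power-of-log rate**: for every `i` there is `κ_i` such that for every `N`
there is `K ≥ 0` with `|Σ_{j ≤ z}Σ_{de=j} G(d)G(e)(log d − log e)ⁱ − κ_i| ≤ K/(1 + log z)ᴺ` for all `z ≥ 1`.
[cite: MontgomeryVaughan2007, §2.1 — derivation (product of two convergent sums)] -/
theorem exists_abs_sum_G_logDiff_kernel_sub_le_pow (i : ℕ) :
    ∃ κ : ℝ, ∀ N : ℕ, ∃ K : ℝ, 0 ≤ K ∧ ∀ z : ℝ, 1 ≤ z →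
      |(∑ j ∈ Icc 1 ⌊z⌋₊, ∑ x ∈ j.divisorsAntidiagonal, G x.1 * G x.2 * (Real.log x.1 - Real.log x.2) ^ i) - κ| ≤
        K / (1 + Real.log z) ^ N := by
  have h := fun a : ℕ ↦ exists_abs_moebius_logPow_hyperbola_sub_le_pow a (i - a)
  choose κ hκ using h
  refine ⟨∑ a ∈ Finset.range (i + 1), (Nat.choose i a : ℝ) * (-1) ^ (i - a) * κ a, fun N ↦ ?_⟩
  have hN := fun a : ℕ ↦ hκ a N
  choose K hK0 hK using hN
  refine ⟨∑ a ∈ Finset.range (i + 1), (Nat.choose i a : ℝ) * K a,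
    Finset.sum_nonneg fun a _ ↦ mul_nonneg (Nat.cast_nonneg _) (hK0 a), fun z hz ↦ ?_⟩
  rw [sum_sum_divisorsAntidiagonal_G_logDiff_pow_eq i ⌊z⌋₊, ← Finset.sum_sub_distrib, Finset.sum_div]
  refine (Finset.abs_sum_le_sum_abs _ _).trans (Finset.sum_le_sum fun a _ ↦ ?_)
  rw [← mul_sub, abs_mul, abs_mul, abs_pow, abs_neg, abs_one, one_pow, mul_one, Nat.abs_cast, mul_div_assoc]
  exact mul_le_mul_of_nonneg_left (hK a z hz) (Nat.cast_nonneg _)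

/-- **Uniform bound of the good kernels' partial sums**: `∀ i, ∃ B ≥ 0, ∀ z, |Σ_{j ≤ z}Σ_{de=j} G(d)G(e)(log d − log e)ⁱ| ≤ B`. [folklore] -/
theorem exists_abs_sum_G_logDiff_kernel_le (i : ℕ) :
    ∃ B : ℝ, 0 ≤ B ∧ ∀ z : ℝ,
      |∑ j ∈ Icc 1 ⌊z⌋₊, ∑ x ∈ j.divisorsAntidiagonal, G x.1 * G x.2 * (Real.log x.1 - Real.log x.2) ^ i| ≤ B := by
  obtain ⟨κ, hκ⟩ := exists_abs_sum_G_logDiff_kernel_sub_le_pow i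
  obtain ⟨K, hK, hKz⟩ := hκ 0
  refine ⟨K + |κ|, by positivity, fun z ↦ ?_⟩
  rcases lt_or_ge z 1 with hz | hz
  · have : ⌊z⌋₊ = 0 := Nat.floor_eq_zero.mpr hz
    rw [this, show Finset.Icc (1 : ℕ) 0 = ∅ from Finset.Icc_eq_empty (by norm_num), Finset.sum_empty, abs_zero]
    positivity
  · have h1 := hKz z hz
    rw [pow_zero, div_one] at h1
    set S := ∑ j ∈ Icc 1 ⌊z⌋₊, ∑ x ∈ j.divisorsAntidiagonal, G x.1 * G x.2 * (Real.log x.1 - Real.log x.2) ^ i with hS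
    have : |S| ≤ |S - κ| + |κ| := by
      have := abs_add_le (S - κ) κ
      simpa using this
    linarith

end Summit.Parity.GeneralizedHardyLittlewood.Theorems.MomentsBeyondDiagonal.DiagCorner

end
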